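/-
Copyright: rh-split cell, typer-2 gen 9, 2026-08-28.  LADDER-RH bookkeeping (route ScrewPolyaSigns, glue
item); nothing in this file bears on the truth of RH.
-/
import Mathlib.Tactic.Linarith
import Summits.RiemannHypothesis.RiemannHypothesis.Theses.ScrewPolyaSigns
import HarnessLib

/-!
# [24908] `ScrewPolyaSigns.ScrewSignSparseGlue` — the kink–valley census glue (PROVED)

Item stmt-RiemannHypothesis-24908 of route `ScrewPolyaSigns` (support, rank 303, size S):
`KinkValleyCensus → ScrewSignSparseKV → ScrewSignSparse`.  The census ([24906]) shadows every strictly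
sign-alternating chain of Suzuki's screw function `Ψ = zetaScrew` in `[0, T]` by a kink–valley chain of
the SAME length in `[0, T+1]`; the kink–valley bound ([24907]) at `T + 1` gives `n ≤ D(T+1) + B`, i.e.
`ScrewSignSparse` ([24182]) with constants `(D, B + D)` and `π·D < 10⁵` unchanged.  Proof = rh-idea-1 g5's
attached sketch `screwSignSparse_of_census` (pub/ideators/rh-idea-1/kv/Sketch.lean 3ad95313f14f5306,
farm rc 0), cross-read with rh-split-ref-2 g8's independent re-proof V-5 `glue_replay`
(KV_vet_ref2.lean 5cd340730750bc0e); keyed to this seat by director-rh (BE1)/(E) and rh-split-lead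
RULING #472/#490.  0 RH content: the two hypotheses stay open route items.

HONEST LABEL: SPLITTING SEARCH over kernel-typed RH-EQUIVALENCES; a splitting `A ∧ B ⟹ RH` is CONDITIONAL
bookkeeping unless `A` and `B` are both proved; nothing here bears on the truth of RH.
-/

-- D-0017: `Summit.RiemannHypothesis.RiemannHypothesis.…` duplicates the namespace BY DESIGN (single-problem summit).
set_option linter.dupNamespace false

namespace Summit.RiemannHypothesis.RiemannHypothesis.Theorems

open Summit.RiemannHypothesis.RiemannHypothesis.Theses.ScrewPolyaSigns in
/-- **[24908] glue, proved.**  `KinkValleyCensus → ScrewSignSparseKV → ScrewSignSparse`: given the census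
and the kink–valley bound with constants `(D, B)`, every strictly increasing, strictly sign-alternating
chain of `zetaScrew` in `[0, T]` is shadowed by a kink–valley chain of equal length in `[0, T + 1]`, whose
length is `≤ D(T+1) + B = D·T + (B + D)`; so `ScrewSignSparse` holds with `(D, B + D)`, `π·D < 10⁵`
unchanged (constants `D ↦ D`, `B ↦ B + D`, window `[0,T] ↦ [0,T+1]`). -/
theorem screwSignSparseGlue_proof :
    Summit.RiemannHypothesis.RiemannHypothesis.Theses.ScrewPolyaSigns.ScrewSignSparseGlue := by
  unfold ScrewSignSparseGlue
  intro hC hKV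
  obtain ⟨D, B, hD, h⟩ := hKV
  refine ⟨D, B + D, hD, ?_⟩
  intro T hT n t ht hmem halt
  obtain ⟨t', ht', hmem', halt', hkink, hvalley⟩ := hC T hT n t ht hmem halt
  have hT1 : 0 ≤ T + 1 := by linarith
  have := h (T + 1) hT1 n t' ht' hmem' halt' hkink hvalley
  linarith

end Summit.RiemannHypothesis.RiemannHypothesis.Theorems
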